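import Literature.AlgebraicGeometry.Motives.UniversalHyperplaneSectionFamily
import Literature.AlgebraicGeometry.HodgeTheory.MotivatedClassesDeformationInputs
import Literature.AlgebraicGeometry.Resolution.AlterationsSmoothOverOpenHolds
import HarnessLib

/-!
# The family of hyperplane sections of the fibres of a smooth projective family, II: flatness at smooth fibres

Topic `Literature/AlgebraicGeometry/Motives` (theorems only; no definitions, no named facts). For the
family of hyperplane sections of the fibres `g = (toX ≫ f, proj) : 𝒴 ⟶ S × (ℙᴺ)^*` of a smooth
projective family `f : 𝒳 ⟶ S` of `(n+1)`-folds over a smooth irreducible affine base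
(`Motives/UniversalHyperplaneSectionFamily`), this file proves:

* `exists_iso_of_range_map_eq` — two reduced closed subschemes of a `ℂ`-scheme locally of finite type
  with the same complex points are isomorphic over it (the universal property of the reduced induced
  structure, Stacks 0356, both ways; the images agree because closed subsets of a Jacobson space are the
  closures of their closed points);
* `isIntegral_total_left`, `isIntegral_section_left`, `smoothOfRelativeDimension_section_hom` — `𝒳` and
  `𝒴` are integral, `𝒴` is smooth over `ℂ` of relative dimension `(N - 1) + (n + 1 + dim S)`;
* `flat_stalkMap_sectionFamily` — **`g` is flat at every point of a smooth `n`-dimensional fibre**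
  (de Jong 1996, 2.8 = Matsumura Thm. 23.1 in the regular-fibre form
  `Literature.RingTheory.Flat.flat_of_isRegularLocalRing_of_isRegularLocalRing_fiber`: the base is
  regular, the fibre ring is the regular local ring of the smooth fibre, and
  `dim 𝒪_{S × (ℙᴺ)^*, g y} + dim 𝒪_{𝒴_{g y}, y} ≤ dim 𝒪_{𝒴, y}` by the dimension count for the
  integral variety `𝒴`).

Sequel: `UniversalHyperplaneSectionFamilyGoodLocus`.

## References

* [DeJong1996] A. J. de Jong, Smoothness, semi-stability and alterations, Publ. Math. IHÉS 83 (1996), 2.8.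
* [Matsumura1987] H. Matsumura, Commutative Ring Theory (1986), Thm. 23.1.
* [StacksProject] The Stacks Project, Tag 0356.
* [VoisinHodgeII2003] C. Voisin, Hodge Theory and Complex Algebraic Geometry II, CUP 2003, §2.1.1, §3.2.2.
-/

noncomputable section

open CategoryTheory CategoryTheory.Limits AlgebraicGeometry TopologicalSpace MonoidalCategory
  CartesianMonoidalCategory
open Literature.AlgebraicGeometry.HodgeTheory
open Literature.AlgebraicGeometry.Motives.UniversalHyperplaneSection

universe u

namespace Literature.AlgebraicGeometry.Motives.SectionFamily

/-! ### Reduced closed subschemes with the same complex points are isomorphic -/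

section Avatar

variable {X Z₁ Z₂ : SchemeOver ℂ} (i₁ : Z₁ ⟶ X) (i₂ : Z₂ ⟶ X)

/-- For a closed immersion `i : Z ⟶ X` of `ℂ`-schemes locally of finite type, the closed points of
the image of `i` are underlying points of complex points in the image of `Z(ℂ) → X(ℂ)`. [folklore] -/
theorem range_left_inter_closedPoints_subset [LocallyOfFiniteType X.hom] [IsClosedImmersion i₁.left]
    [IsClosedImmersion i₂.left]
    (h : Set.range (AlgPoints.map (L := ℂ) i₁) ⊆ Set.range (AlgPoints.map (L := ℂ) i₂)) :
    Set.range i₁.left.base ∩ closedPoints X.left ⊆ Set.range i₂.left.base := by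
  rintro x ⟨hx, hxc⟩
  obtain ⟨P, hP⟩ := EsnaultLevineViehweg.exists_algPoints_pt_eq (X := X) (k := ℂ)
    (mem_closedPoints_iff.mp hxc)
  have hP' : P.pt ∈ Set.range i₁.left.base := by rw [hP]; exact hx
  obtain ⟨Q, hQ⟩ := h ⟨AlgPoints.liftClosed i₁ P hP', AlgPoints.map_liftClosed i₁ P hP'⟩
  rw [← hP, ← hQ, AlgPoints.pt_map]
  exact ⟨Q.pt, rfl⟩

/-- For closed immersions `i₁, i₂` into a `ℂ`-scheme locally of finite type with
`i₁(Z₁(ℂ)) ⊆ i₂(Z₂(ℂ))`, the image of `i₁` lies in the image of `i₂` (closed subsets of a Jacobson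
space are the closures of their closed points). [folklore] -/
theorem range_left_subset_of_range_map_subset [LocallyOfFiniteType X.hom] [IsClosedImmersion i₁.left]
    [IsClosedImmersion i₂.left]
    (h : Set.range (AlgPoints.map (L := ℂ) i₁) ⊆ Set.range (AlgPoints.map (L := ℂ) i₂)) :
    Set.range i₁.left.base ⊆ Set.range i₂.left.base := by
  haveI : JacobsonSpace X.left := LocallyOfFiniteType.jacobsonSpace X.hom
  have h₁ : IsClosed (Set.range i₁.left.base) := i₁.left.isClosedEmbedding.isClosed_range
  have h₂ : IsClosed (Set.range i₂.left.base) := i₂.left.isClosedEmbedding.isClosed_range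
  rw [← closure_inter_closedPoints h₁]
  exact closure_minimal (range_left_inter_closedPoints_subset i₁ i₂ h) h₂

/-- **Two reduced closed subschemes of a `ℂ`-scheme locally of finite type with the same complex
points are isomorphic over it** (universal property of the reduced induced structure, Stacks 0356,
in both directions; the images agree because they have the same closed points). [cite: StacksProject, Tag 0356] -/
theorem exists_iso_of_range_map_eq [LocallyOfFiniteType X.hom] [IsClosedImmersion i₁.left]
    [IsClosedImmersion i₂.left] [IsReduced Z₁.left] [IsReduced Z₂.left]
    (h : Set.range (AlgPoints.map (L := ℂ) i₁) = Set.range (AlgPoints.map (L := ℂ) i₂)) :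
    ∃ φ : Z₁ ≅ Z₂, φ.hom ≫ i₂ = i₁ := by
  have h12 := range_left_subset_of_range_map_subset i₁ i₂ h.le
  have h21 := range_left_subset_of_range_map_subset i₂ i₁ h.ge
  let l₁ : Z₁ ⟶ Z₂ := Over.homMk (liftOfRangeSubset i₂.left i₁.left h12) (by
    rw [← Over.w i₂, ← Category.assoc, liftOfRangeSubset_comp, Over.w i₁])
  let l₂ : Z₂ ⟶ Z₁ := Over.homMk (liftOfRangeSubset i₁.left i₂.left h21) (by
    rw [← Over.w i₁, ← Category.assoc, liftOfRangeSubset_comp, Over.w i₂])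
  have hl₁ : l₁ ≫ i₂ = i₁ := by ext : 1; exact liftOfRangeSubset_comp _ _ h12
  have hl₂ : l₂ ≫ i₁ = i₂ := by ext : 1; exact liftOfRangeSubset_comp _ _ h21
  haveI : Mono i₁ := (Over.forget _).mono_of_mono_map (inferInstanceAs (Mono i₁.left))
  haveI : Mono i₂ := (Over.forget _).mono_of_mono_map (inferInstanceAs (Mono i₂.left))
  refine ⟨⟨l₁, l₂, ?_, ?_⟩, hl₁⟩
  · rw [← cancel_mono i₁, Category.assoc, hl₂, hl₁, Category.id_comp]
  · rw [← cancel_mono i₂, Category.assoc, hl₁, hl₂, Category.id_comp]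

end Avatar

/-! ### Integrality and dimension of `𝒴`; `g` is flat at the points of a smooth fibre -/

section SmoothLocus

variable {n N d : ℕ} {𝒳 S : SchemeOver ℂ} (f : 𝒳 ⟶ S) (e : 𝒳 ⟶ projectiveSpace N ℂ)

/-- The total space of a smooth projective family over a smooth irreducible base is integral.
[folklore] -/
theorem isIntegral_total_left (hf : IsSmoothProjectiveFamily f (n + 1)) [IrreducibleSpace S.left]
    [Smooth S.hom] : IsIntegral 𝒳.left := by
  haveI : LocallyOfFiniteType S.hom := inferInstance
  haveI := irreducibleSpace_of_isSmoothProjectiveFamily f hf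
  haveI : Smooth f.left := hf.smooth
  haveI : Smooth 𝒳.hom := by rw [← Over.w f]; infer_instance
  haveI : IsReduced 𝒳.left := isReduced_of_smooth_over_field 𝒳.hom
  exact isIntegral_of_irreducibleSpace_of_isReduced _

/-- The universal hyperplane section `𝒴` of an integral `𝒳` (for an affine `e : 𝒳 ⟶ ℙᴺ`, `N ≥ 2`)
is integral. [folklore] -/
theorem isIntegral_section_left [IsIntegral 𝒳.left] [IsAffineHom e.left] (hN : 2 ≤ N) :
    IsIntegral (universalHyperplaneSection N e).left := by
  haveI := geometricallyIntegral_of_isAlgClosed 𝒳.hom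
  haveI : GeometricallyIrreducible 𝒳.hom := inferInstance
  haveI := UniversalHyperplaneSection.geometricallyIrreducible_hom e hN
  haveI : Subsingleton ((Functor.fromPUnit (Spec (CommRingCat.of ℂ))).obj
      (universalHyperplaneSection N e).right) := inferInstanceAs (Subsingleton (PrimeSpectrum ℂ))
  haveI : Nonempty ((Functor.fromPUnit (Spec (CommRingCat.of ℂ))).obj
      (universalHyperplaneSection N e).right) := inferInstanceAs (Nonempty (PrimeSpectrum ℂ))
  haveI : IrreducibleSpace (universalHyperplaneSection N e).left :=
    GeometricallyIrreducible.irreducibleSpace_of_subsingleton (universalHyperplaneSection N e).hom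
  haveI := UniversalHyperplaneSection.isReduced_universalHyperplaneSection_left N e
  exact isIntegral_of_irreducibleSpace_of_isReduced _

/-- `𝒴 ⟶ Spec ℂ` is smooth of relative dimension `N - 1 + (n + 1 + d)` when `𝒳 ⟶ Spec ℂ` is smooth of
relative dimension `n + 1 + d` (the `ℙᴺ⁻¹`-bundle `𝒴 ⟶ 𝒳`). [cite: VoisinHodgeII2003, §2.1.1] -/
theorem smoothOfRelativeDimension_section_hom [SmoothOfRelativeDimension (n + 1 + d) 𝒳.hom]
    [IsAffineHom e.left] :
    SmoothOfRelativeDimension (N - 1 + (n + 1 + d)) (universalHyperplaneSection N e).hom :=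
  UniversalHyperplaneSection.smoothOfRelativeDimension_hom e (n + 1 + d)

/-- **`g` is flat at every point of a smooth `n`-dimensional fibre** (de Jong 1996, 2.8 /
Matsumura Thm. 23.1, regular-fibre form): the local ring of `S × (ℙᴺ)^*` at `g y` is regular, the
fibre ring `𝒪_{𝒴,y}/𝔪_{g y}𝒪_{𝒴,y}` is the regular local ring of the smooth fibre, and
`dim 𝒪_{S × (ℙᴺ)^*, g y} + dim 𝒪_{𝒴_{g y}, y} ≤ dim 𝒪_{𝒴, y}` because `𝒴` is an integral variety of
dimension `(N - 1) + (n + 1 + d)` over the `(d + N)`-dimensional base with `n`-dimensional fibre.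
[cite: DeJong1996, 2.8] [cite: Matsumura1987, Thm. 23.1] -/
theorem flat_stalkMap_sectionFamily (hf : IsSmoothProjectiveFamily f (n + 1)) [IrreducibleSpace S.left]
    [SmoothOfRelativeDimension d S.hom] [IsAffine S.left] [IsAffineHom e.left] (hN : 2 ≤ N)
    (b : ComplexPoints (S ⊗ dualProjectiveSpace N ℂ))
    (hb : SmoothOfRelativeDimension n
      (fiberOver (CartesianMonoidalCategory.lift (toX N e ≫ f) (proj N e)) b).hom)
    (y : (universalHyperplaneSection N e).left)
    (hy : (CartesianMonoidalCategory.lift (toX N e ≫ f) (proj N e)).left.base y = b.pt) :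
    ((CartesianMonoidalCategory.lift (toX N e ≫ f) (proj N e)).left.stalkMap y).hom.Flat := by
  -- players and instances
  haveI : Smooth S.hom := SmoothOfRelativeDimension.smooth d _
  haveI : LocallyOfFiniteType S.hom := inferInstance
  haveI : IsSeparated S.hom := inferInstance
  haveI := isIntegral_total_left f hf
  haveI := isIntegral_section_left e hN
  haveI := smoothOfRelativeDimension_total_hom f hf (d := d)
  haveI := smoothOfRelativeDimension_section_hom (n := n) (N := N) (d := d) e
  haveI : Smooth (universalHyperplaneSection N e).hom :=
    SmoothOfRelativeDimension.smooth (N - 1 + (n + 1 + d)) _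
  haveI : LocallyOfFiniteType (universalHyperplaneSection N e).hom := inferInstance
  haveI := smoothOfRelativeDimension_dualProjectiveSpace_hom (N := N)
  haveI := smoothOfRelativeDimension_tensorObj_hom S (dualProjectiveSpace N ℂ) (d := d) (m := N)
  haveI : Smooth (S ⊗ dualProjectiveSpace N ℂ).hom := SmoothOfRelativeDimension.smooth (N + d) _
  haveI : LocallyOfFiniteType (S ⊗ dualProjectiveSpace N ℂ).hom := inferInstance
  haveI : IsSeparated (dualProjectiveSpace N ℂ).hom := inferInstance
  haveI := isSeparated_tensorObj_hom S (dualProjectiveSpace N ℂ)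
  haveI := locallyOfFiniteType_total_hom f hf
  haveI := locallyOfFiniteType_sectionFamily_left f e
  haveI : IsLocallyNoetherian (universalHyperplaneSection N e).left :=
    LocallyOfFiniteType.isLocallyNoetherian (universalHyperplaneSection N e).hom
  set g := CartesianMonoidalCategory.lift (toX N e ≫ f) (proj N e) with hg
  -- the rings
  set A := (S ⊗ dualProjectiveSpace N ℂ).left.presheaf.stalk (g.left.base y) with hA
  set B := (universalHyperplaneSection N e).left.presheaf.stalk y with hB
  letI : Algebra A B := (g.left.stalkMap y).hom.toAlgebra
  haveI : IsLocalHom (algebraMap A B) := inferInstanceAs (IsLocalHom (g.left.stalkMap y).hom)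
  haveI : IsRegularLocalRing A :=
    Literature.AlgebraicGeometry.Resolution.isRegularLocalRing_stalk_of_smooth_of_field
      (S ⊗ dualProjectiveSpace N ℂ).hom (g.left.base y)
  haveI : IsNoetherianRing B :=
    inferInstanceAs (IsNoetherianRing ((universalHyperplaneSection N e).left.presheaf.stalk y))
  -- the fibre through `y` is smooth of relative dimension `n`
  obtain ⟨hsm, hsmn⟩ := smooth_fiberToSpecResidueField_of_fiberOver g b hb
  have hsm' : Smooth (g.left.fiberToSpecResidueField (g.left.base y)) := by rw [hy]; exact hsm
  have hsmn' : SmoothOfRelativeDimension n (g.left.fiberToSpecResidueField (g.left.base y)) := by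
    rw [hy]; exact hsmn
  -- the fibre ring is the (regular) local ring of the smooth fibre
  obtain ⟨e₀⟩ := Literature.AlgebraicGeometry.Motives.nonempty_stalkFiber_ringEquiv_asFiber g.left y
  have hregF : IsRegularLocalRing ((g.left.fiber (g.left.base y)).presheaf.stalk (g.left.asFiber y)) :=
    @Literature.AlgebraicGeometry.Resolution.isRegularLocalRing_stalk_of_smooth_of_field _ _ _
      (g.left.fiberToSpecResidueField (g.left.base y)) hsm' (g.left.asFiber y)
  haveI := hregF
  have hF' : IsRegularLocalRing (B ⧸ (IsLocalRing.maximalIdeal A).map (algebraMap A B)) :=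
    IsRegularLocalRing.of_ringEquiv e₀
  -- dimensions
  haveI : Nonempty (universalHyperplaneSection N e).left := ⟨y⟩
  haveI : Nonempty (S ⊗ dualProjectiveSpace N ℂ).left := ⟨g.left.base y⟩
  have hdimY : topologicalKrullDim (universalHyperplaneSection N e).left = (N - 1 + (n + 1 + d) : ℕ) :=
    topologicalKrullDim_eq_of_smoothOfRelativeDimension (universalHyperplaneSection N e).hom _
  have hdimB : topologicalKrullDim (S ⊗ dualProjectiveSpace N ℂ).left ≤ (N + d : ℕ) :=
    (topologicalKrullDim_eq_of_smoothOfRelativeDimension (S ⊗ dualProjectiveSpace N ℂ).hom _).le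
  have hfibdim : ∀ C ∈ irreducibleComponents (↥(g.left.fiber (g.left.base y)) : Type),
      topologicalKrullDim C ≤ (n : ℕ) := by
    intro C _
    haveI : Nonempty (g.left.fiber (g.left.base y)) := ⟨g.left.asFiber y⟩
    have hfd := @topologicalKrullDim_eq_of_smoothOfRelativeDimension _ _ _
      (g.left.fiberToSpecResidueField (g.left.base y)) n hsmn' _
    rw [← hfd]
    exact topologicalKrullDim_subspace_le _ C
  have hle := Literature.AlgebraicGeometry.Dimension.ringKrullDim_stalk_add_ringKrullDim_stalk_fiber_le
    (universalHyperplaneSection N e).hom (S ⊗ dualProjectiveSpace N ℂ).hom g.left (Over.w g)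
    (n := N - 1 + (n + 1 + d)) (m := N + d) (r := n) (by omega) hdimY hdimB y hfibdim
  have hdimF : ringKrullDim ((g.left.fiber (g.left.base y)).presheaf.stalk (g.left.asFiber y)) =
      ringKrullDim (B ⧸ (IsLocalRing.maximalIdeal A).map (algebraMap A B)) :=
    ringKrullDim_eq_of_ringEquiv e₀
  have hdim : ringKrullDim A + ringKrullDim (B ⧸ (IsLocalRing.maximalIdeal A).map (algebraMap A B)) ≤
      ringKrullDim B := by
    rw [← hdimF]
    exact hle
  -- Matsumura 23.1 (regular fibre)
  have hflat : Module.Flat A B :=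
    Literature.RingTheory.Flat.flat_of_isRegularLocalRing_of_isRegularLocalRing_fiber hF' hdim
  exact hflat

end SmoothLocus

end Literature.AlgebraicGeometry.Motives.SectionFamily

end
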